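import Summits.QuantumFields.YangMills.Theorems.SwapVirialDeficitTwoScaleHadamard
import HarnessLib

/-!
# The PERIODIC massive-mode rung, brick PM-IIa(i′): the two-variable Hadamard lemma FROM `ContDiff` — the grid of directional derivatives
# (free-hands support of ⟨stmt-QuantumFields-24196⟩ `SwapVirialDeficit.ToronSoftnessSharp`; bridge from a smooth `G : ℝ × ℝ × Y → ℝ` to the grid hypotheses of
# ✓`BlowUp.exists_continuous_twoVarHadamard` (PM-IIa(i)), for LEAD ym-line-sfw-p2 g96's PM-IIb)

For `G : ℝ × ℝ × Y → ℝ` (`Y` a real normed space) with `ContDiff ℝ k G` for every `k : ℕ`, the grid `D i j := ∂ᵤ^[i] (∂ₛ^[j] G)` of iterated DIRECTIONAL derivatives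
(`∂ₑF := fun q => fderiv ℝ F q e`, `eᵤ = (1,0,0)`, `eₛ = (0,1,0)`) satisfies both line relations (the `s`-relation through the symmetry of second derivatives
✓`ContDiffAt.isSymmSndFDerivAt`, iterated), is smooth, and identifies with one-variable `iteratedDeriv`s of the slices.  OUTPUT ★★★ `exists_continuous_twoVarHadamard_of_contDiff`:
`(ha) iteratedDeriv j (s ↦ G(u,s,y)) 0 = 0 (j < n)`, `(hb) iteratedDeriv i (u ↦ G(u,s,y)) 0 = 0 (i < m)` ⟹ `∃ Φ` jointly continuous, `G(u,s,y) = uᵐ sⁿ Φ(u,s,y)`,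
`Φ(0,0,y) = ∂ᵤᵐ∂ₛⁿG(0,0,y)/(m!n!) = iteratedDeriv m (u ↦ iteratedDeriv n (s ↦ G(u,s,y)) 0) 0/(m!n!)`.
HONEST LABEL: calculus; PM-IIb is LEAD g96's and NOT proved here; ⟨24196⟩/⟨24497⟩ OPEN; own crux ⟨22884⟩ OPEN (blocked-on ⟨19935⟩); the Yang–Mills mass gap is NOT proved;
no summit is proved by a line.  Width seat ym-line-sfw-p2-w3 g64 (cell ym-idea-1, free hands), `--supports stmt-QuantumFields-24196`.  THEOREMS ONLY (0 `def`, 0 `sorry`),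
standard axioms.  References: [folklore] (Schwarz/Clairaut; Hadamard); [cite: Luscher1983, §2] for the use.
-/

set_option autoImplicit false

noncomputable section

open Set Filter Topology
open scoped Nat

namespace Summit.QuantumFields.YangMills.Theorems.SwapVirialDeficit.BlowUp

/-! ## §1 Directional-derivative operators `∂ₑ F = (q ↦ fderiv ℝ F q e)` on a normed space -/

section DirDeriv

variable {Z : Type*} [NormedAddCommGroup Z] [NormedSpace ℝ Z]

/-- `∂ₑ` preserves `C^k` for all `k` (one degree at a time). [folklore] -/
theorem contDiff_dirDeriv {F : Z → ℝ} (hF : ∀ k : ℕ, ContDiff ℝ k F) (e : Z) (k : ℕ) : ContDiff ℝ k (fun q => fderiv ℝ F q e) :=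
  ((hF (k + 1)).fderiv_right (m := k) (by norm_cast)).clm_apply contDiff_const

/-- Iterates of `∂ₑ` preserve smoothness. [folklore] -/
theorem contDiff_iterate_dirDeriv {F : Z → ℝ} (hF : ∀ k : ℕ, ContDiff ℝ k F) (e : Z) (i : ℕ) :
    ∀ k : ℕ, ContDiff ℝ k ((fun F' : Z → ℝ => fun q => fderiv ℝ F' q e)^[i] F) := by
  induction i with
  | zero => simpa using hF
  | succ i ih => intro k; rw [Function.iterate_succ_apply']; exact contDiff_dirDeriv ih e k

/-- `∂ₑ∂ₑ′F(q) = D²F(q)[e, e′]`. [folklore] -/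
theorem dirDeriv_dirDeriv_eq {F : Z → ℝ} (hF : ∀ k : ℕ, ContDiff ℝ k F) (e e' : Z) (q : Z) :
    fderiv ℝ (fun q' => fderiv ℝ F q' e') q e = fderiv ℝ (fderiv ℝ F) q e e' := by
  have hd : DifferentiableAt ℝ (fderiv ℝ F) q :=
    (((hF 2).fderiv_right (m := 1) (by norm_cast)).differentiable (by norm_cast)).differentiableAt
  rw [fderiv_clm_apply hd (differentiableAt_const _)]
  simp

/-- Schwarz/Clairaut for directional derivatives: `∂ₑ∂ₑ′F = ∂ₑ′∂ₑF` for smooth `F`. [folklore] -/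
theorem dirDeriv_comm {F : Z → ℝ} (hF : ∀ k : ℕ, ContDiff ℝ k F) (e e' : Z) :
    (fun q => fderiv ℝ (fun q' => fderiv ℝ F q' e') q e) = fun q => fderiv ℝ (fun q' => fderiv ℝ F q' e) q e' := by
  funext q
  rw [dirDeriv_dirDeriv_eq hF e e' q, dirDeriv_dirDeriv_eq hF e' e q]
  exact (hF 2).contDiffAt.isSymmSndFDerivAt (by simp) e e'

/-- Iterated commutation: `∂ₑ^[i] (∂ₑ′ F) = ∂ₑ′ (∂ₑ^[i] F)`. [folklore] -/
theorem iterate_dirDeriv_comm {F : Z → ℝ} (hF : ∀ k : ℕ, ContDiff ℝ k F) (e e' : Z) (i : ℕ) :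
    (fun F' : Z → ℝ => fun q => fderiv ℝ F' q e)^[i] (fun q => fderiv ℝ F q e') =
      fun q => fderiv ℝ ((fun F' : Z → ℝ => fun q => fderiv ℝ F' q e)^[i] F) q e' := by
  induction i with
  | zero => rfl
  | succ i ih =>
    rw [Function.iterate_succ_apply', ih, Function.iterate_succ_apply']
    exact dirDeriv_comm (contDiff_iterate_dirDeriv hF e i) e e'

end DirDeriv

/-! ## §2 The coordinate lines of `ℝ × ℝ × Y` -/

section Lines

variable {Y : Type*} [NormedAddCommGroup Y] [NormedSpace ℝ Y]

/-- Along the `u`-line: `d/du F(u, p) = ∂_{(1,0,0)}F`. [folklore] -/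
theorem hasDerivAt_line_u {F : ℝ × ℝ × Y → ℝ} (hF : Differentiable ℝ F) (q : ℝ × ℝ × Y) :
    HasDerivAt (fun u => F (u, q.2)) (fderiv ℝ F q ((1 : ℝ), (0 : ℝ), (0 : Y))) q.1 := by
  have hl : HasDerivAt (fun u : ℝ => ((u, q.2.1, q.2.2) : ℝ × ℝ × Y)) ((1 : ℝ), (0 : ℝ), (0 : Y)) q.1 :=
    (hasDerivAt_id q.1).prodMk ((hasDerivAt_const q.1 q.2.1).prodMk (hasDerivAt_const q.1 q.2.2))
  exact (hF (q.1, q.2.1, q.2.2)).hasFDerivAt.comp_hasDerivAt q.1 hl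

/-- Along the `s`-line: `d/ds F(u, s, y) = ∂_{(0,1,0)}F`. [folklore] -/
theorem hasDerivAt_line_s {F : ℝ × ℝ × Y → ℝ} (hF : Differentiable ℝ F) (q : ℝ × ℝ × Y) :
    HasDerivAt (fun s => F (q.1, s, q.2.2)) (fderiv ℝ F q ((0 : ℝ), (1 : ℝ), (0 : Y))) q.2.1 := by
  have hl : HasDerivAt (fun s : ℝ => ((q.1, s, q.2.2) : ℝ × ℝ × Y)) ((0 : ℝ), (1 : ℝ), (0 : Y)) q.2.1 :=
    (hasDerivAt_const q.2.1 q.1).prodMk ((hasDerivAt_id q.2.1).prodMk (hasDerivAt_const q.2.1 q.2.2))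
  exact (hF (q.1, q.2.1, q.2.2)).hasFDerivAt.comp_hasDerivAt q.2.1 hl

/-- Iterated `u`-derivatives identify with `iteratedDeriv` of the `u`-slice: `(∂ᵤ^[i] F)(u, p) = iteratedDeriv i (u ↦ F(u,p)) u`. [folklore] -/
theorem iterate_dirDeriv_u_eq_iteratedDeriv {F : ℝ × ℝ × Y → ℝ} (hF : ∀ k : ℕ, ContDiff ℝ k F) (i : ℕ) (p : ℝ × Y) (u : ℝ) :
    ((fun F' : ℝ × ℝ × Y → ℝ => fun q => fderiv ℝ F' q ((1 : ℝ), (0 : ℝ), (0 : Y)))^[i] F) (u, p) = iteratedDeriv i (fun u' => F (u', p)) u := by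
  have hchain := iteratedDeriv_eq_of_derivChain (n := i)
    (F := fun j u' => ((fun F' : ℝ × ℝ × Y → ℝ => fun q => fderiv ℝ F' q ((1 : ℝ), (0 : ℝ), (0 : Y)))^[j] F) (u', p))
    (fun j _ u' => by
      rw [Function.iterate_succ_apply']
      exact hasDerivAt_line_u ((contDiff_iterate_dirDeriv hF _ j 1).differentiable (by norm_cast)) (u', p))
  exact (congrFun (hchain i le_rfl) u).symm

/-- Iterated `s`-derivatives identify with `iteratedDeriv` of the `s`-slice. [folklore] -/
theorem iterate_dirDeriv_s_eq_iteratedDeriv {F : ℝ × ℝ × Y → ℝ} (hF : ∀ k : ℕ, ContDiff ℝ k F) (j : ℕ) (u : ℝ) (y : Y) (s : ℝ) :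
    ((fun F' : ℝ × ℝ × Y → ℝ => fun q => fderiv ℝ F' q ((0 : ℝ), (1 : ℝ), (0 : Y)))^[j] F) (u, s, y) = iteratedDeriv j (fun s' => F (u, s', y)) s := by
  have hchain := iteratedDeriv_eq_of_derivChain (n := j)
    (F := fun j' s' => ((fun F' : ℝ × ℝ × Y → ℝ => fun q => fderiv ℝ F' q ((0 : ℝ), (1 : ℝ), (0 : Y)))^[j'] F) (u, s', y))
    (fun j' _ s' => by
      rw [Function.iterate_succ_apply']
      exact hasDerivAt_line_s ((contDiff_iterate_dirDeriv hF _ j' 1).differentiable (by norm_cast)) (u, s', y))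
  exact (congrFun (hchain j le_rfl) s).symm

/-! ## §3 The bridge -/

/-- ★★★ **TWO-VARIABLE HADAMARD FROM SMOOTHNESS.**  `G : ℝ × ℝ × Y → ℝ` smooth (`C^k` for all `k`), `0 < m`, `0 < n`,
(ha) `∂ₛʲG(u, 0, y) = 0` for `j < n` and (hb) `∂ᵤⁱG(0, s, y) = 0` for `i < m` (as one-variable `iteratedDeriv`s of the slices) ⟹ `G = uᵐ sⁿ Φ` with `Φ` JOINTLY
continuous and `Φ(0,0,y) = iteratedDeriv m (u ↦ iteratedDeriv n (s ↦ G(u,s,y)) 0) 0 / (m!·n!)`. [folklore] -/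
theorem exists_continuous_twoVarHadamard_of_contDiff {G : ℝ × ℝ × Y → ℝ} (hG : ∀ k : ℕ, ContDiff ℝ k G) {m n : ℕ} (hm : 0 < m) (hn : 0 < n)
    (ha : ∀ j < n, ∀ (u : ℝ) (y : Y), iteratedDeriv j (fun s => G (u, s, y)) 0 = 0)
    (hb : ∀ i < m, ∀ (s : ℝ) (y : Y), iteratedDeriv i (fun u => G (u, s, y)) 0 = 0) :
    ∃ Φ : ℝ × ℝ × Y → ℝ, Continuous Φ ∧ (∀ q, G q = q.1 ^ m * q.2.1 ^ n * Φ q) ∧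
      ∀ y, Φ (0, 0, y) = iteratedDeriv m (fun u => iteratedDeriv n (fun s => G (u, s, y)) 0) 0 / (m ! * n !) := by
  -- the grid
  set Du : (ℝ × ℝ × Y → ℝ) → (ℝ × ℝ × Y → ℝ) := fun F' q => fderiv ℝ F' q ((1 : ℝ), (0 : ℝ), (0 : Y)) with hDu
  set Ds : (ℝ × ℝ × Y → ℝ) → (ℝ × ℝ × Y → ℝ) := fun F' q => fderiv ℝ F' q ((0 : ℝ), (1 : ℝ), (0 : Y)) with hDs
  set D : ℕ → ℕ → ℝ × ℝ × Y → ℝ := fun i j => Du^[i] (Ds^[j] G) with hD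
  have hsmooth_s : ∀ j : ℕ, ∀ k : ℕ, ContDiff ℝ k (Ds^[j] G) := fun j => contDiff_iterate_dirDeriv hG _ j
  have hsmooth : ∀ i j : ℕ, ∀ k : ℕ, ContDiff ℝ k (D i j) := fun i j => contDiff_iterate_dirDeriv (hsmooth_s j) _ i
  have hu : ∀ i < m, ∀ j ≤ n, ∀ q : ℝ × ℝ × Y, HasDerivAt (fun u => D i j (u, q.2)) (D (i + 1) j q) q.1 := by
    intro i _ j _ q
    have h := hasDerivAt_line_u ((hsmooth i j 1).differentiable (by norm_cast)) q
    have he : D (i + 1) j = Du (D i j) := by simp only [hD]; rw [Function.iterate_succ_apply']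
    rw [he]; exact h
  have hs : ∀ i ≤ m, ∀ j < n, ∀ q : ℝ × ℝ × Y, HasDerivAt (fun s => D i j (q.1, s, q.2.2)) (D i (j + 1) q) q.2.1 := by
    intro i _ j _ q
    have h := hasDerivAt_line_s ((hsmooth i j 1).differentiable (by norm_cast)) q
    have he : D i (j + 1) = Ds (D i j) := by
      simp only [hD]
      rw [Function.iterate_succ_apply']
      exact iterate_dirDeriv_comm (hsmooth_s j) _ _ i
    rw [he]; exact h
  have hc : ∀ i ≤ m, ∀ j ≤ n, Continuous (D i j) := fun i _ j _ => (hsmooth i j 0).continuous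
  -- vanishing data via the slices
  have hDs_slice : ∀ j u y s, (Ds^[j] G) (u, s, y) = iteratedDeriv j (fun s' => G (u, s', y)) s :=
    fun j u y s => iterate_dirDeriv_s_eq_iteratedDeriv hG j u y s
  have hDu_slice : ∀ i j (p : ℝ × Y) u, D i j (u, p) = iteratedDeriv i (fun u' => (Ds^[j] G) (u', p)) u :=
    fun i j p u => iterate_dirDeriv_u_eq_iteratedDeriv (hsmooth_s j) i p u
  have ha' : ∀ j < n, ∀ (u : ℝ) (y : Y), D 0 j (u, 0, y) = 0 := by
    intro j hj u y
    simp only [hD, Function.iterate_zero, id]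
    rw [hDs_slice]; exact ha j hj u y
  have hb' : ∀ i < m, ∀ (s : ℝ) (y : Y), D i 0 (0, s, y) = 0 := by
    intro i hi s y
    rw [hDu_slice]; simp only [Function.iterate_zero, id]
    exact hb i hi s y
  obtain ⟨Φ, hΦc, hΦ, hΦ0⟩ := exists_continuous_twoVarHadamard hm hn hu hs hc ha' hb'
  refine ⟨Φ, hΦc, fun q => ?_, fun y => ?_⟩
  · have := hΦ q; simpa [hD] using this
  · rw [hΦ0 y, hDu_slice]
    congr 2
    funext u
    exact hDs_slice n u y 0

end Lines

end Summit.QuantumFields.YangMills.Theorems.SwapVirialDeficit.BlowUp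

end
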